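import Summits.MatrixMultiplication.MatrixMultiplication.Theses.FidelityWitnesses
import Summits.MatrixMultiplication.MatrixMultiplication.Theorems.LinearDefectLaw.Negative.TwoByTwoRungs
import Literature.Computability.AlgebraicComplexity.BorderRankMatMulTwoHolds
import Summits.MatrixMultiplication.MatrixMultiplication.Theorems.FidelityWitnessesLinearDefectLawStubOneStepGain
import Summits.MatrixMultiplication.MatrixMultiplication.Theorems.FidelityWitnessesLinearDefectLawStubFreeUnitProduct
import Summits.MatrixMultiplication.MatrixMultiplication.Theorems.FidelityWitnessesLinearDefectLawStubUnusedDirection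
import Summits.MatrixMultiplication.MatrixMultiplication.Theorems.FidelityWitnessesLinearDefectLawStubCriticalGram
import Summits.MatrixMultiplication.MatrixMultiplication.Theorems.FidelityWitnessesLinearDefectLawStubPassage
import Summits.MatrixMultiplication.MatrixMultiplication.Theorems.FidelityWitnessesLinearDefectLawStubFreeUnitProductDet

/-!
# Line `border-singular-values` for crux `FidelityWitnesses.LinearDefectLaw` (stmt-MatrixMultiplication-14039)

Skeleton (crux-plan, planner-cruxplan-stmt-MatrixMultiplication-14039-border-singular-valu-0, 2026-08-16) of idea
card `Cruxes/LinearDefectLaw/Ideas/border-singular-values.md` (crux-ideate r1, ideator 2; triage r1-1, r1-2, r1-3: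
**pass** ×3 — "same lever as unit-residual-telescoping / spectral-persistence in its cleanest form; take THIS card's
`UnitSlope` / `SpectralResidual` (δ-optimal) as the canonical C⁺ of the merged line"). Line card:
`Lines/border-singular-values.md`.

THE CRUX. `LinearDefectLaw : ∀ n r S, tensorRank S ≤ r → |⟨S,⟨n,n,n⟩⟩|² ≤ (n³ + r − R̲(⟨n,n,n⟩))·‖S‖²`
(`M(n,r) := sup_{R(S) ≤ r} |⟨S,T⟩|²/‖S‖² ≤ n³ − (R̲ − r)`: Frobenius error buys border rank no cheaper than deleting
unit products; `R̲` = the tree's `algBorderRank` over `ℂ`).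

THE LINE (border singular values / spectral-residual telescoping). `T = ⟨n,n,n⟩`, `P n = Fin n × Fin n`, slots
`a = (κ,ν)` (output), `b = (κ,μ)`, `c = (μ,ν)`; `overlap S = Σ S·T`, `normSq S = Σ‖S‖²`, `fid S = |overlap S|²/normSq S`
(`= ‖P_{ℂS} T‖²`), `resid S = T − P_{ℂS} T` (entrywise `T − (conj (overlap S)/normSq S)·S`), `triEval E x y z = Σ E x y z`
(so `sup` over unit `x,y,z` of `|triEval E x y z|` is the spectral norm `‖E‖_σ`).
* TRANSFER `C⁺ = UnitSlope` (def below): below the border rank one more (border) multiplication buys at least one more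
  full unit — if `c` bounds `|overlap|²/normSq` at rank `r+1` and `r < R̲(T)` then `c − 1` bounds it at rank `r`.
  GLUE `UnitSlope → LinearDefectLaw` is PROVED (`law_of_unitSlope`, the ideator's downward telescoping from the
  Cauchy–Schwarz level `r = R̲`, where the constant is `n³`; no closure fact, no Alder–Strassen, `R̲` never computed).
* `stub_oneStepGain` (S1, two-plane Bessel, provable now, size M): projecting `T` onto `span(S, x̄⊗ȳ⊗z̄)` instead of
  `ℂ·S` gains at least `|resid S (x,y,z)|²` of fidelity, at rank `≤ r + 1` — the tensor shadow of
  `‖P − P_(k)‖_op = σ_{k+1}(P)`.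
* `stub_freeUnitProduct` (S2, the unconditional first rungs, provable now, size M): for `r ≤ 2n − 2` EVERY rank-`≤ r`
  tensor is annihilated by some unit triad `(x,y,z)` on which `T` evaluates to `1` (a rotated unit product
  `(p⊗q, p̄⊗s, s̄⊗q̄)`, found by kernel counting: `q` free, `p ⟂` the `≤ n−1` forms `p ↦ pᵀU_l q`, `s ⟂` the rest) —
  with S1 this gives `UnitSlope` at every level `r ≤ 2n − 2` for free (`slope_small`), no optimality, no `R̲`.
* `stub_spectralResidual` (S3 = the idea's lever `SpectralResidual` on the WINDOW `2n − 1 ≤ r < R̲(T)`; THE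
  LOAD-BEARING, hardest stub, size XL): every δ-near-optimal rank-`≤ r` approximant `S ≠ 0` of `T` leaves a residual of
  spectral norm `≥ 1 − ε` — "what is still missing always contains one whole unit triad"; equality at the
  partial-matrix-multiplication optima `(2,5)` (Bini pair) and `(2,6)` (`resid = a₂₂⊗b₂₂⊗c₂₂`).
* COMPOSITION (kernel-checked, no `sorry` of its own): S1 + S3 ⇒ `UnitSlope` on the window by a `sup`-bookkeeping
  argument over `δ`-optimal tensors (`slope_window`, proved here: `M_r := sSup fid(rank ≤ r) ≤ c − 1`); S1 + S2 ⇒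
  `UnitSlope` below the window (`slope_small`); hence `UnitSlope` (`unitSlope_of_stubs`), hence the crux
  (`linearDefectLaw_of_stubs`, explicit-hypothesis form; `LinearDefectLaw_of : LinearDefectLaw`, by name).

DISPROOF USED (`Cruxes/LinearDefectLaw/Disproof.lean`, cdisprove cycle 1, and the LANDED
`Theorems/LinearDefectLaw/Negative/TwoByTwoRungs.lean`, imported here). (H = the rank bound,
`linearDefectLaw_false_without_rank`): the line uses H at S3 and only there in substance — near-optimality is AMONG
rank-`≤ r` tensors and `r < R̲` (drop the rank bound and `S = T` is optimal with `resid = 0`); S1 uses it only as the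
bookkeeping `rank(S + λt) ≤ r + 1`, S2 as "`S` is a sum of `r ≤ 2n−2` triads". (Tightness, `linearDefectLaw_tight_two_six`,
`LinearDefectLawNeg.linearDefectLaw_tight_two_five`, `MredZ_vals`) — the lever has EQUALITY cases exactly there
(`‖resid‖_σ = 1` on the nose: Bini pair at `(2,5)`, one unit product at `(2,6)`), so S3 asks for `1 − ε` at
`δ`-optima, never `1 + η`, and `unitSlope_not_strengthened` below derives from `linearDefectLaw_tight_two_six` that the
unit in `UnitSlope` cannot be raised (`c − 1 − η` is false at `(2,6)`). (No uniform slack, `linearDefectLaw_not_slack`)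
— consistent: the composition produces the law's constant exactly, no slack. (Non-additivity,
`linearDefectLaw_not_additive_at_five`) — `UnitSlope` asks increments `≥ 1`, not `= 1` (measured `1.006, 1.41, 1.59,
1.000` at `n = 2`). (Kill shape, `linearDefectLaw_not_of_int`) — a kill of the crux kills S3 (S1, S2 are theorems);
a kill of S3 alone (a certified nearest point with a diffuse residual, `‖E‖_σ < 1`) does NOT kill the crux: the line
card names the fallback (`UnitSlope` itself, which tolerates re-optimisation slack). Negatives index
(`ledger negatives --problem MatrixMultiplication`, per triage r1-1/2/3: four STPP/design refutations) — unrelated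
statements; no stub is an instance of a refuted statement or of a landed Negative lemma.

LEAD (prover-line-stmt-MatrixMultiplication-14039-0, 2026-08-16, line PICKED). Reshape r0: the three registered stub signatures
are stated RAW (only `tensorRank`, `matMulTensor`, `algBorderRank`, finite sums, `starRingEnd ℂ`; no line vocabulary), so that a
stub lands as a self-contained `Theorems/FidelityWitnessesLinearDefectLaw<Stub>.lean` whose theorem matches the registered signature
verbatim; the vocabulary forms `oneStepGain` / `freeUnitProduct` / `spectralResidual` are their definitional unfoldings and feed the
unchanged composition.
-/

noncomputable section

namespace Summit.MatrixMultiplication.MatrixMultiplication.Cruxes.LinearDefectLaw.BorderSingularValues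

open scoped BigOperators ComplexConjugate
open Literature.Computability.AlgebraicComplexity
open Summit.MatrixMultiplication.MatrixMultiplication.Theses.FidelityWitnesses (LinearDefectLaw)
open Summit.MatrixMultiplication.MatrixMultiplication.Theorems

set_option linter.unusedVariables false
set_option linter.dupNamespace false

/-! ## Vocabulary (as in the ideator's `Ideator2Sketch.lean`) -/

/-- index type of one slot of `⟨n,n,n⟩` -/
abbrev P (n : ℕ) : Type := Fin n × Fin n

/-- bilinear overlap `Σ S·⟨n,n,n⟩` (the crux's numerator before `‖·‖²`; `= conj ⟨S,T⟩`, `T` real). -/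
def overlap {n : ℕ} (S : P n → P n → P n → ℂ) : ℂ :=
  ∑ a, ∑ b, ∑ c, S a b c * matMulTensor ℂ n n n a b c

/-- squared Frobenius norm `Σ ‖S_{abc}‖²`. -/
def normSq {n : ℕ} (S : P n → P n → P n → ℂ) : ℝ :=
  ∑ a, ∑ b, ∑ c, ‖S a b c‖ ^ 2

/-- fidelity numerator `|Σ S·T|² / Σ‖S‖²` (`= ‖P_{ℂS} T‖²`; junk value `0` at `S = 0`). -/
def fid {n : ℕ} (S : P n → P n → P n → ℂ) : ℝ :=
  ‖overlap S‖ ^ 2 / normSq S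

/-- residual of `T = ⟨n,n,n⟩` after orthogonal projection onto the complex line `ℂ·S`:
`E_S = T − (⟨S,T⟩/⟨S,S⟩)·S` (entrywise; `resid 0 = T`). -/
def resid {n : ℕ} (S : P n → P n → P n → ℂ) : P n → P n → P n → ℂ :=
  fun a b c => matMulTensor ℂ n n n a b c - (conj (overlap S) / (normSq S : ℂ)) * S a b c

/-- trilinear evaluation `E(x,y,z) = Σ E_{abc} x_a y_b z_c`; `sup |E(x,y,z)|` over unit `x, y, z` is the
spectral (injective) norm `‖E‖_σ`. -/
def triEval {n : ℕ} (E : P n → P n → P n → ℂ) (x y z : P n → ℂ) : ℂ :=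
  ∑ a, ∑ b, ∑ c, E a b c * x a * y b * z c

/-- unit vector in one slot -/
def IsUnitVec {n : ℕ} (x : P n → ℂ) : Prop := ∑ i, ‖x i‖ ^ 2 = 1

/-- **The Transfer `C⁺ = UnitSlope`** ("every border singular value of `⟨n,n,n⟩` is at least one"): below
the border rank, one more (border) multiplication buys at least one more full unit of overlap. `R̲` enters only
through the hypothesis `r < R̲`. Implies the crux (`law_of_unitSlope`, proved); implied by the three stubs
(`unitSlope_of_stubs`, proved). -/
def UnitSlope : Prop :=
  ∀ (n r : ℕ) (c : ℝ), r < algBorderRank (matMulTensor ℂ n n n) →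
    (∀ S' : P n → P n → P n → ℂ, tensorRank S' ≤ r + 1 → ‖overlap S'‖ ^ 2 ≤ c * normSq S') →
    ∀ S : P n → P n → P n → ℂ, tensorRank S ≤ r → ‖overlap S‖ ^ 2 ≤ (c - 1) * normSq S

/-! ## The stubs -/

/-- **Stub S1 — `OneStepGain` (two-plane Bessel; provable now, size M).** For `S ≠ 0` of rank `≤ r` and unit
vectors `x, y, z`, some tensor of rank `≤ r + 1` has fidelity at least `fid S + |resid S (x,y,z)|²`.
Why true: put `t := x̄⊗ȳ⊗z̄` (unit; `triEval E x y z = ⟨t, E⟩`), `V := span(S, t)`, `S' := P_V T` (`= αS + βt`, so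
`rank S' ≤ r + 1` by `tensorRank_add_le`, `tensorRank_smul_le`, rank of a triad `≤ 1`); then `fid S' = ‖P_V T‖²`
(`⟨S',T⟩ = ‖P_V T‖²`) and Gram–Schmidt `e₁ = S/‖S‖`, `e₂ ∝ t − ⟨e₁,t⟩e₁` gives
`‖P_V T‖² = |⟨e₁,T⟩|² + |⟨e₂,T⟩|² = fid S + |⟨t, resid S⟩|²/(1 − |⟨e₁,t⟩|²) ≥ fid S + |resid S (x,y,z)|²`
(if `t ∥ S` the gain term is `0` since `resid S ⟂ S`). Mathlib: `Finset.inner_mul_le_norm_mul_norm`,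
`Submodule.starProjection`/explicit two-vector algebra over `EuclideanSpace ℂ (P n × P n × P n)`, or the direct
computation `fid(αS + βt) ≥ …` at the optimal `(α, β)` (a quadratic form in two variables). It is the
two-dimensional version of the sibling theorem `Theorems.exists_sum_norm_sq_mul_sub_lt` (projection onto a
complex line). Equality version (`Telescoping` of card unit-residual-telescoping): with `S' = S + E(x,y,z)·t`
one has `‖T − S'‖² = ‖T − S‖² − |E(x,y,z)|²` at the optimal scale. -/
theorem stub_oneStepGain :
    ∀ (n r : ℕ) (S : Fin n × Fin n → Fin n × Fin n → Fin n × Fin n → ℂ) (x y z : Fin n × Fin n → ℂ),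
      tensorRank S ≤ r → S ≠ 0 →
      (∑ i, ‖x i‖ ^ 2) = 1 → (∑ i, ‖y i‖ ^ 2) = 1 → (∑ i, ‖z i‖ ^ 2) = 1 →
      ∃ S' : Fin n × Fin n → Fin n × Fin n → Fin n × Fin n → ℂ, tensorRank S' ≤ r + 1 ∧
        ‖∑ a, ∑ b, ∑ c, S a b c * matMulTensor ℂ n n n a b c‖ ^ 2 / (∑ a, ∑ b, ∑ c, ‖S a b c‖ ^ 2) +
          ‖∑ a, ∑ b, ∑ c, (matMulTensor ℂ n n n a b c -
              (starRingEnd ℂ) (∑ a', ∑ b', ∑ c', S a' b' c' * matMulTensor ℂ n n n a' b' c') /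
                ((∑ a', ∑ b', ∑ c', ‖S a' b' c'‖ ^ 2 : ℝ) : ℂ) * S a b c) * x a * y b * z c‖ ^ 2 ≤
        ‖∑ a, ∑ b, ∑ c, S' a b c * matMulTensor ℂ n n n a b c‖ ^ 2 / (∑ a, ∑ b, ∑ c, ‖S' a b c‖ ^ 2) := by
  exact Theorems.LinearDefectLaw.OneStepGain.stub_oneStepGain

/-- **Stub S2 — `FreeUnitProduct` below the window (the unconditional first rungs; provable now, size M).**
If `r ≤ 2n − 2`, every tensor `S` of rank `≤ r` is annihilated by a unit triad `(x, y, z)` on which `⟨n,n,n⟩`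
evaluates to exactly `1`. Why true (card §First lemma, verified on paper by triage r1-2/r1-3): write
`S = Σ_{l<r} u_l ⊗ v_l ⊗ w_l` (`exists_eq_sum_triad_of_tensorRank_le`); take the ROTATED UNIT PRODUCT
`x = p⊗q` (`x (κ,ν) = p κ q ν`), `y = p̄⊗s` (`y (κ,μ) = conj (p κ) s μ`), `z = s̄⊗q̄` (`z (μ,ν) = conj (s μ) conj (q ν)`)
with unit `p, q, s : Fin n → ℂ`; then `triEval T x y z = ‖p‖²‖q‖²‖s‖² = 1` (the only `(a,b,c)` with `T = 1` are
`a = (κ,ν), b = (κ,μ), c = (μ,ν)`), and `triEval S x y z = Σ_l (pᵀU_l q)(p^*V_l s)(s^* W_l q̄)` where `U_l, V_l, W_l`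
are `u_l, v_l, w_l` read as `n × n` matrices. Split the `r ≤ 2n−2` indices into `L₁ ⊔ L₂` with `|L₁|, |L₂| ≤ n − 1`;
fix any unit `q`; choose unit `p` in the kernel of the `≤ n−1` linear forms `p ↦ pᵀU_l q` (`l ∈ L₁`) and then unit
`s` in the kernel of the `≤ n−1` forms `s ↦ p^*V_l s` (`l ∈ L₂`) — nonzero kernels by dimension count in `ℂⁿ`
(`LinearMap.exists_ne_zero_mem_ker_of_finrank_lt`-type lemma / `Submodule.finrank_le` on the span of `≤ n−1`
functionals); every summand then has a vanishing factor. No optimality and no border rank is used; the statement is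
FALSE for all `S` from `r ≈ 3n − 2` on (Ideator-1's positive-coverage family `Σ_λ (v_λv_λ^*)^{⊗3}`, triage r1-2), which
is why the window stub S3 below quantifies over near-optimal `S` only. With S1 it yields `UnitSlope` at every level
`r ≤ 2n − 2` (`slope_small`), i.e. `M(n, r+1) ≥ M(n, r) + 1` there, unconditionally. -/
theorem stub_freeUnitProduct :
    ∀ (n r : ℕ) (S : Fin n × Fin n → Fin n × Fin n → Fin n × Fin n → ℂ), r + 2 ≤ 2 * n → tensorRank S ≤ r →
      ∃ x y z : Fin n × Fin n → ℂ, (∑ i, ‖x i‖ ^ 2) = 1 ∧ (∑ i, ‖y i‖ ^ 2) = 1 ∧ (∑ i, ‖z i‖ ^ 2) = 1 ∧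
        (∑ a, ∑ b, ∑ c, S a b c * x a * y b * z c) = 0 ∧
        (∑ a, ∑ b, ∑ c, matMulTensor ℂ n n n a b c * x a * y b * z c) = 1 := by
  exact Theorems.LinearDefectLaw.FreeUnitProduct.stub_freeUnitProduct

/-- **Stub S2⁺ — `FreeUnitProductDet`: the free regime extended by one rung, `r ≤ 2n − 1` (reshape r2, lead; provable now,
size M).** For `n ≥ 2` and `r + 1 ≤ 2n`, EVERY tensor of rank `≤ r` is annihilated by a rotated unit product on which `⟨n,n,n⟩`
evaluates to `1` — one rung more than `stub_freeUnitProduct` (`r ≤ 2n − 2`, p84979), which it subsumes for `n ≥ 2`; in particular the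
thinnest charted instance `(2,3)` of the old core (margin 0.5 %) becomes unconditional and the open window now starts at `r = 2n`.
(`n ≥ 2` is needed: at `n = 1`, `r = 1`, a nonzero `S` never vanishes on a unit triad.)
PAPER PROOF (lead, 2026-08-16). Write `S = Σ_{l<r} triad (w l) (u l) (v l)` (`exists_eq_sum_triad_of_tensorRank_le`), `r ≤ 2n − 1`,
and read `w l` as the `n × n` matrix `W_l (κ,ν) := w l (κ,ν)`, `u l` as `U_l (κ,μ)`. On the rotated unit product `x = p⊗q`,
`y = p̄⊗s`, `z = s̄⊗q̄` (unit `p q s : Fin n → ℂ`) one has `T(x,y,z) = 1` and `S(x,y,z) = Σ_l α_l β_l γ_l` with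
`α_l = Σ_{κν} W_l(κ,ν)·p κ·q ν`, `β_l = Σ_{κμ} U_l(κ,μ)·conj(p κ)·s μ` (`FreeUnitProduct.ev_sum_triad`, `ev_matMulTensor`,
`sum_norm_sq_eq_one`). Let `A` := the first `min(r,n)` indices, `B` := the rest (`|B| ≤ r − n ≤ n − 1` when `r ≥ n`; if `r < n`, `A` = all,
`B = ∅`). (1) CHOOSE `q` (only needed when `|A| = n`): `D(q) := det [ (W_l q)_κ ]_{κ, l ∈ A}` is a homogeneous polynomial of degree `n`
in `q ∈ ℂⁿ`; it has a nontrivial zero: with `e₀, e₁` two distinct basis vectors (`n ≥ 2`), `f(t) := D(e₀ + t·e₁)` is a complex polynomial;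
if `f` is non-constant it has a root (`Complex.exists_root` / `IsAlgClosed.exists_root`); if `f ≡ c ≠ 0` is constant then
`g(t) := D(t·e₀ + e₁) = tⁿ·f(1/t)` for `t ≠ 0`, so `g(t) = c·tⁿ` on `t ≠ 0`, hence (polynomial identity) `g = c·Xⁿ` and `g(0) = D(e₁) = 0`;
if `f ≡ 0` then `q = e₀` works. (Any implementation of "a degree-`n ≥ 1` form in `≥ 2` variables over ℂ has a nonzero zero" is fine.)
With `D(q) = 0` the `n × n` matrix `M := [(W_l q)_κ]` is singular, so some `p ≠ 0` has `Σ_κ (W_l q)_κ p κ = 0` for every `l ∈ A`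
(`Matrix.exists_mulVec_eq_zero_iff`/`Matrix.exists_vecMul_eq_zero_iff` : `det M = 0 ↔ ∃ v ≠ 0, …`), i.e. `α_l = 0` on `A`; if `|A| < n`
instead choose `p` directly in the common kernel of the `≤ n − 1` functionals `p ↦ α_l` (`FreeUnitProduct.exists_unit_orth`), any `q`.
Normalise `p`, `q` (the conditions are homogeneous). (2) CHOOSE `s`: the `|B| ≤ n − 1` functionals `s ↦ β_l` (`l ∈ B`, coefficients
`Σ_κ U_l(κ,μ) conj(p κ)`) have a common unit zero (`exists_unit_orth`), i.e. `β_l = 0` on `B`. Every summand of `S(x,y,z)` has a vanishing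
factor, so `S(x,y,z) = 0` and `T(x,y,z) = 1`. The further extension to `r ≤ 3n − 3` is TRUE (lead's dossier: `n − 1` polynomial
conditions on `q`, degeneracy loci of matrices of linear forms + projective dimension theorem) but needs intersection theory. -/
theorem stub_freeUnitProductDet :
    ∀ (n r : ℕ) (S : Fin n × Fin n → Fin n × Fin n → Fin n × Fin n → ℂ), 2 ≤ n → r + 1 ≤ 2 * n →
      tensorRank S ≤ r →
      ∃ x y z : Fin n × Fin n → ℂ, (∑ i, ‖x i‖ ^ 2) = 1 ∧ (∑ i, ‖y i‖ ^ 2) = 1 ∧ (∑ i, ‖z i‖ ^ 2) = 1 ∧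
        (∑ a, ∑ b, ∑ c, S a b c * x a * y b * z c) = 0 ∧
        (∑ a, ∑ b, ∑ c, matMulTensor ℂ n n n a b c * x a * y b * z c) = 1 := by
  exact Theorems.LinearDefectLaw.FreeUnitProductDet.stub_freeUnitProductDet

/-! ### Reshape r1 (lead, 2026-08-16): S3 = `passage ∘ (criticalGram, unusedDirection, core)`

`stub_spectralResidual` (S3, δ-optimal honest form) is no longer a registered stub: it is PROVED below from four registered
stubs, three of them provable now —
* `stub_passage` (compactness, size L): the exact-maximiser law `RSL(n,r)` ("every nonzero fidelity maximiser `S*` of level `r`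
  in the closed cone, at optimal scale, leaves `‖T − S*‖_σ ≥ 1`, exhibited") implies S3 at level `(n,r)` (normalise a violating
  δ_k-optimal sequence to the `normSq`-sphere, extract a convergent subsequence in the compact sphere, the limit is a maximiser
  after rescaling to optimal scale, RSL gives a unit triad there, continuity of `S ↦ resid S (x,y,z)` at the limit contradicts);
* `stub_criticalGram` (first-order optimality under `GL(n²)³`, size L; card ccnf L1): at such a maximiser
  `S_(p) T_(p)^* = S_(p) S_(p)^*` in the three modes (`(1 + tX)·_p` preserves the closed cone; the real quadratic
  `t ↦ |ov(S_t)|² − ns(S*)·ns(S_t) ≤ 0` vanishes at `t = 0`, so its derivative does; `X` and `iX`);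
* `stub_unusedDirection` (size M; card ccnf L2 / URL_of_unusedRankOne; TRUE FOR EVERY `S`): a rank-one matrix `η = u v^*`
  killing `S` in some mode (`η^* S_(p) = 0`) exhibits a unit triad on which `T − S` evaluates to exactly `1`;
* `stub_core` (THE OPEN CORE, size XL): at a CONCISE maximiser (no unused rank-one direction in any mode) in the window
  `2n ≤ r < R̲` (r2; was `2n − 1 ≤ r` in r1), given the critical Gram identity, some unit triad sees a full unit of `T − S*`.
Composition: `rsl_of_stubs` (case split on the unused direction) and `stub_spectralResidual := stub_passage _ _ (rsl_of_stubs …)`.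
All four signatures are RAW (tree constants + finite sums only). -/

/-- **Stub S3a — `UnusedDirection` (provable now, size M; every tensor `S`, no optimality).** If some mode of `S` is killed
by a rank-one matrix `η = u v^*` (`u, v ≠ 0`; mode A: `Σ_a conj(u a.1)·v a.2·S a b c = 0` for all `b c`, etc.), then some
unit triad `(x,y,z)` has `|Σ (T − S) x y z| ≥ 1` (in fact `= 1`). Construction (mode A): `x a := conj(u a.1)·v a.2/(‖u‖‖v‖)`
kills `S`, and `Σ T x y z = Σ_{a,μ} x a · y (a.1,μ) · z (μ,a.2)` (`FreeUnitProduct.ev_matMulTensor`) equals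
`Σ |u_i|²|v_j|²|w_μ|²/(‖u‖²‖v‖²) = 1` for `y (i,μ) := u i·conj(w μ)/‖u‖`, `z (μ,j) := w μ·conj(v j)/‖v‖`, `w` any unit
vector; mode B: `y b := conj(u b.1)·v b.2/(‖u‖‖v‖)`, `x (κ,ν) := u κ·conj(w ν)/‖u‖`, `z (μ,ν) := conj(v μ)·w ν/‖v‖`;
mode C: `z c := conj(u c.1)·v c.2/(‖u‖‖v‖)`, `x (κ,ν) := w κ·conj(v ν)/‖v‖`, `y (κ,μ) := conj(w κ)·u μ/‖u‖`. -/
theorem stub_unusedDirection :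
    ∀ (n : ℕ) (S : Fin n × Fin n → Fin n × Fin n → Fin n × Fin n → ℂ),
      ((∃ u v : Fin n → ℂ, u ≠ 0 ∧ v ≠ 0 ∧
          ∀ b c : Fin n × Fin n, (∑ a : Fin n × Fin n, (starRingEnd ℂ) (u a.1) * v a.2 * S a b c) = 0) ∨
        (∃ u v : Fin n → ℂ, u ≠ 0 ∧ v ≠ 0 ∧
          ∀ a c : Fin n × Fin n, (∑ b : Fin n × Fin n, (starRingEnd ℂ) (u b.1) * v b.2 * S a b c) = 0) ∨
        (∃ u v : Fin n → ℂ, u ≠ 0 ∧ v ≠ 0 ∧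
          ∀ a b : Fin n × Fin n, (∑ c : Fin n × Fin n, (starRingEnd ℂ) (u c.1) * v c.2 * S a b c) = 0)) →
      ∃ x y z : Fin n × Fin n → ℂ, (∑ i, ‖x i‖ ^ 2) = 1 ∧ (∑ i, ‖y i‖ ^ 2) = 1 ∧ (∑ i, ‖z i‖ ^ 2) = 1 ∧
        1 ≤ ‖∑ a, ∑ b, ∑ c, (matMulTensor ℂ n n n a b c - S a b c) * x a * y b * z c‖ := by
  exact Theorems.LinearDefectLaw.UnusedDirection.stub_unusedDirection

/-- **Stub S3b — `CriticalGram` at fidelity maximisers (provable now, size L; card ccnf lever L1).** Let `S` be a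
nonzero point of the closed cone `closure {rank ≤ r}` at optimal scale (`Σ S·T = Σ‖S‖²`) maximising the fidelity against every
honest rank-`≤ r` tensor (`|Σ S'·T|² ≤ ‖S‖²·‖S'‖²`). Then `S_(p) T_(p)^* = S_(p) S_(p)^*` entrywise in each mode `p`.
Why true: (1) the maximiser inequality extends to every `S'` in the closure (both sides continuous in `S'`); (2) for a matrix
`X` on slot A and real `t`, `S_t := S + t·(X ·_A S)`, `(X ·_A S) a b c = Σ_{a'} X a a' S a' b c`, lies in the closure (the
linear map `1 + tX ·_A` is continuous and maps triads to triads, hence `{rank ≤ r}` into itself and its closure into its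
closure, `image_closure_subset_closure_image`); (3) `g(t) := |ov S_t|² − ns S · ns S_t ≤ 0` is a real quadratic in `t` with
`g(0) = 0` (`ov S = ns S`), so `g'(0) = 0`: `Re ov(X·S) = Re ⟪S, X·S⟫`; with `iX` also the imaginary parts; (4) taking `X`
elementary gives `Σ_{bc} S a' b c·T a b c = Σ_{bc} S a' b c·conj(S a b c)` for all `a, a'`, i.e. the mode-A identity
(`T` is real: `conj T = T`, `OneStepGain.conj_matMulTensor`); modes B, C alike. -/
theorem stub_criticalGram :
    ∀ (n r : ℕ) (S : Fin n × Fin n → Fin n × Fin n → Fin n × Fin n → ℂ),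
      S ∈ closure {S' : Fin n × Fin n → Fin n × Fin n → Fin n × Fin n → ℂ | tensorRank S' ≤ r} → S ≠ 0 →
      (∑ a, ∑ b, ∑ c, S a b c * matMulTensor ℂ n n n a b c) = ((∑ a, ∑ b, ∑ c, ‖S a b c‖ ^ 2 : ℝ) : ℂ) →
      (∀ S' : Fin n × Fin n → Fin n × Fin n → Fin n × Fin n → ℂ, tensorRank S' ≤ r →
        ‖∑ a, ∑ b, ∑ c, S' a b c * matMulTensor ℂ n n n a b c‖ ^ 2 ≤
          (∑ a, ∑ b, ∑ c, ‖S a b c‖ ^ 2) * ∑ a, ∑ b, ∑ c, ‖S' a b c‖ ^ 2) →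
      (∀ a a' : Fin n × Fin n, (∑ b, ∑ c, S a b c * (starRingEnd ℂ) (matMulTensor ℂ n n n a' b c)) =
          ∑ b, ∑ c, S a b c * (starRingEnd ℂ) (S a' b c)) ∧
      (∀ b b' : Fin n × Fin n, (∑ a, ∑ c, S a b c * (starRingEnd ℂ) (matMulTensor ℂ n n n a b' c)) =
          ∑ a, ∑ c, S a b c * (starRingEnd ℂ) (S a b' c)) ∧
      (∀ c c' : Fin n × Fin n, (∑ a, ∑ b, S a b c * (starRingEnd ℂ) (matMulTensor ℂ n n n a b c')) =
          ∑ a, ∑ b, S a b c * (starRingEnd ℂ) (S a b c')) := by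
  exact Theorems.LinearDefectLaw.CriticalGram.stub_criticalGram

/-- **Stub S3c — `Passage` from exact maximisers to δ-optimal honest tensors (provable now, size L; compactness).**
If at level `(n, r)` every nonzero optimal-scale fidelity maximiser `S*` of the closed cone has a unit triad with
`|Σ (T − S*) x y z| ≥ 1`, then S3 holds at level `(n, r)`: for every `ε > 0` some `δ > 0` makes every nonzero honest
`δ`-optimal rank-`≤ r` tensor `S` have a unit triad with `|resid S (x,y,z)|² ≥ 1 − ε`.
Why true: suppose not; get honest `S_k ≠ 0`, rank `≤ r`, `1/(k+1)`-optimal, with `|resid S_k (x,y,z)|² < 1 − ε` for all unit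
triads. `fid` and `resid` are invariant under `S ↦ c·S` (`c ≠ 0`) and `rank (c·S) ≤ rank S` (`tensorRank_smul_le`), so WLOG
`Σ‖S_k‖² = 1`; the `normSq`-unit sphere of the Pi type is compact (closed, bounded, `ProperSpace`), so a subsequence converges
to `S∞` with `Σ‖S∞‖² = 1`, `S∞ ∈ closure {rank ≤ r}`; with `M := sSup (fid '' {rank ≤ r})` (bounded by `n³`, and `≥ fid` of
every honest tensor) one gets `fid S∞ = M` by continuity of `fid` at `S∞ ≠ 0`; `S* := (conj (ov S∞)/ns S∞)·S∞` is in the closed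
cone (scalar multiples: `tensorRank_smul_le` + continuity of `c • ·`), at optimal scale, maximising, and `S* ≠ 0` because
`M ≥ 1 > 0` (the unit product `e⊗e⊗e` has rank `≤ 1 ≤ r` and fidelity `1`; `r ≥ 1` since a nonzero tensor of rank `≤ r`
exists, `n ≥ 1` likewise); the hypothesis gives a unit triad with `|Σ (T − S*) x y z| ≥ 1`, and `T − S* = resid S∞`; finally
`S ↦ Σ (resid S) x y z` is continuous at `S∞` (`ns S∞ ≠ 0`), so `|resid S_k (x,y,z)|² → ≥ 1 > 1 − ε` along the subsequence. -/
theorem stub_passage :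
    ∀ (n r : ℕ),
      (∀ S : Fin n × Fin n → Fin n × Fin n → Fin n × Fin n → ℂ,
        S ∈ closure {S' : Fin n × Fin n → Fin n × Fin n → Fin n × Fin n → ℂ | tensorRank S' ≤ r} → S ≠ 0 →
        (∑ a, ∑ b, ∑ c, S a b c * matMulTensor ℂ n n n a b c) = ((∑ a, ∑ b, ∑ c, ‖S a b c‖ ^ 2 : ℝ) : ℂ) →
        (∀ S' : Fin n × Fin n → Fin n × Fin n → Fin n × Fin n → ℂ, tensorRank S' ≤ r →
          ‖∑ a, ∑ b, ∑ c, S' a b c * matMulTensor ℂ n n n a b c‖ ^ 2 ≤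
            (∑ a, ∑ b, ∑ c, ‖S a b c‖ ^ 2) * ∑ a, ∑ b, ∑ c, ‖S' a b c‖ ^ 2) →
        ∃ x y z : Fin n × Fin n → ℂ, (∑ i, ‖x i‖ ^ 2) = 1 ∧ (∑ i, ‖y i‖ ^ 2) = 1 ∧ (∑ i, ‖z i‖ ^ 2) = 1 ∧
          1 ≤ ‖∑ a, ∑ b, ∑ c, (matMulTensor ℂ n n n a b c - S a b c) * x a * y b * z c‖) →
      ∀ ε : ℝ, 0 < ε → ∃ δ : ℝ, 0 < δ ∧
        ∀ S : Fin n × Fin n → Fin n × Fin n → Fin n × Fin n → ℂ, tensorRank S ≤ r → S ≠ 0 →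
          (∀ S' : Fin n × Fin n → Fin n × Fin n → Fin n × Fin n → ℂ, tensorRank S' ≤ r →
            ‖∑ a, ∑ b, ∑ c, S' a b c * matMulTensor ℂ n n n a b c‖ ^ 2 / (∑ a, ∑ b, ∑ c, ‖S' a b c‖ ^ 2) ≤
              ‖∑ a, ∑ b, ∑ c, S a b c * matMulTensor ℂ n n n a b c‖ ^ 2 / (∑ a, ∑ b, ∑ c, ‖S a b c‖ ^ 2)
                + δ) →
          ∃ x y z : Fin n × Fin n → ℂ, (∑ i, ‖x i‖ ^ 2) = 1 ∧ (∑ i, ‖y i‖ ^ 2) = 1 ∧ (∑ i, ‖z i‖ ^ 2) = 1 ∧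
            1 - ε ≤ ‖∑ a, ∑ b, ∑ c, (matMulTensor ℂ n n n a b c -
              (starRingEnd ℂ) (∑ a', ∑ b', ∑ c', S a' b' c' * matMulTensor ℂ n n n a' b' c') /
                ((∑ a', ∑ b', ∑ c', ‖S a' b' c'‖ ^ 2 : ℝ) : ℂ) * S a b c) * x a * y b * z c‖ ^ 2 := by
  exact Theorems.LinearDefectLaw.Passage.stub_passage

/-- **Stub S3d — THE OPEN CORE: unit residual at CONCISE critical maximisers in the window (size XL).**
In the window `2n ≤ r < R̲(⟨n,n,n⟩)` (reshape r2: the rung `r = 2n − 1` is now FREE, `stub_freeUnitProductDet`), let `S` be a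
nonzero optimal-scale fidelity maximiser of the closed cone
`closure {rank ≤ r}` (so `S ≠ T` by Alder–Strassen, `T − S ⟂ S`, `‖T − S‖² = n³ − M(n,r) > 0`), satisfying the critical Gram
identity `S_(p)T_(p)^* = S_(p)S_(p)^*` in all three modes (supplied by `stub_criticalGram`) and CONCISE: no rank-one matrix
kills `S` in any mode (the non-concise case is `stub_unusedDirection`). Then some unit triad sees a full unit of the residual:
`|Σ (T − S) x y z| ≥ 1`, i.e. `‖T − S‖_σ ≥ 1 = ‖T‖_σ`. This is RSL/URL/SpectralResidual of the three cards restricted to the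
stratum where the crux is analog-hard; what the hypotheses give: `K_p := S_(p)T_(p)^*/n` Hermitian, `0 ⪯ K_p ⪯ I`,
`(T−S)_(p)(T−S)_(p)^* = n(I − K_p)`, `‖T − S‖² = n·tr(I − K_p)`, `rank K_p ≥ n² − 2n + 2`; evidence: margins `1.004982` (2,3),
`[1.0618, 1.0740]` (2,4), `1⁺` (2,5), `1` (2,6), `≥ 1` at every computed `n = 3` optimum incl. Smirnov-seeded window points;
at `(2,6)` it implies `SevenEighthsLaw` (stmt-4959). Candidate mechanisms (none proved): coverage/nodal form (some rotated
unit product `t` with `Re⟨S,t⟩ ≤ 0`; `T = n³·𝔼_t t` so `𝔼_t ⟨t, T − S⟩ = ‖T − S‖²/n³`), max-vs-mean on `K_T`-orbits,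
second-order optimality. WHY IT MIGHT FAIL: a concise maximiser at `n ≥ 3` in `[2n² − n, R̲)` with a diffuse residual. -/
theorem stub_core :
    ∀ (n r : ℕ) (S : Fin n × Fin n → Fin n × Fin n → Fin n × Fin n → ℂ),
      2 * n ≤ r → r < algBorderRank (matMulTensor ℂ n n n) →
      S ∈ closure {S' : Fin n × Fin n → Fin n × Fin n → Fin n × Fin n → ℂ | tensorRank S' ≤ r} → S ≠ 0 →
      (∑ a, ∑ b, ∑ c, S a b c * matMulTensor ℂ n n n a b c) = ((∑ a, ∑ b, ∑ c, ‖S a b c‖ ^ 2 : ℝ) : ℂ) →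
      (∀ S' : Fin n × Fin n → Fin n × Fin n → Fin n × Fin n → ℂ, tensorRank S' ≤ r →
        ‖∑ a, ∑ b, ∑ c, S' a b c * matMulTensor ℂ n n n a b c‖ ^ 2 ≤
          (∑ a, ∑ b, ∑ c, ‖S a b c‖ ^ 2) * ∑ a, ∑ b, ∑ c, ‖S' a b c‖ ^ 2) →
      ((∀ a a' : Fin n × Fin n, (∑ b, ∑ c, S a b c * (starRingEnd ℂ) (matMulTensor ℂ n n n a' b c)) =
          ∑ b, ∑ c, S a b c * (starRingEnd ℂ) (S a' b c)) ∧
        (∀ b b' : Fin n × Fin n, (∑ a, ∑ c, S a b c * (starRingEnd ℂ) (matMulTensor ℂ n n n a b' c)) =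
          ∑ a, ∑ c, S a b c * (starRingEnd ℂ) (S a b' c)) ∧
        (∀ c c' : Fin n × Fin n, (∑ a, ∑ b, S a b c * (starRingEnd ℂ) (matMulTensor ℂ n n n a b c')) =
          ∑ a, ∑ b, S a b c * (starRingEnd ℂ) (S a b c'))) →
      ¬ ((∃ u v : Fin n → ℂ, u ≠ 0 ∧ v ≠ 0 ∧
            ∀ b c : Fin n × Fin n, (∑ a : Fin n × Fin n, (starRingEnd ℂ) (u a.1) * v a.2 * S a b c) = 0) ∨
          (∃ u v : Fin n → ℂ, u ≠ 0 ∧ v ≠ 0 ∧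
            ∀ a c : Fin n × Fin n, (∑ b : Fin n × Fin n, (starRingEnd ℂ) (u b.1) * v b.2 * S a b c) = 0) ∨
          (∃ u v : Fin n → ℂ, u ≠ 0 ∧ v ≠ 0 ∧
            ∀ a b : Fin n × Fin n, (∑ c : Fin n × Fin n, (starRingEnd ℂ) (u c.1) * v c.2 * S a b c) = 0)) →
      ∃ x y z : Fin n × Fin n → ℂ, (∑ i, ‖x i‖ ^ 2) = 1 ∧ (∑ i, ‖y i‖ ^ 2) = 1 ∧ (∑ i, ‖z i‖ ^ 2) = 1 ∧
        1 ≤ ‖∑ a, ∑ b, ∑ c, (matMulTensor ℂ n n n a b c - S a b c) * x a * y b * z c‖ := by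
  sorry

/-! ### Vocabulary for the reshaped S3 and its composition (proved) -/

/-- `S` is a nonzero optimal-scale fidelity MAXIMISER of level `r`: a point of the closed cone `closure {rank ≤ r}` with
`Σ S·T = Σ‖S‖²` whose fidelity `normSq S` bounds that of every honest rank-`≤ r` tensor. -/
def IsMaximiser (n r : ℕ) (S : P n → P n → P n → ℂ) : Prop :=
  S ∈ closure {S' : P n → P n → P n → ℂ | tensorRank S' ≤ r} ∧ S ≠ 0 ∧
    overlap S = ((normSq S : ℝ) : ℂ) ∧
    ∀ S' : P n → P n → P n → ℂ, tensorRank S' ≤ r → ‖overlap S'‖ ^ 2 ≤ normSq S * normSq S'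

/-- a UNIT WITNESS for `T − S`: a unit triad on which the plain residual evaluates to modulus `≥ 1` (`‖T − S‖_σ ≥ 1`). -/
def UnitWitness (n : ℕ) (S : P n → P n → P n → ℂ) : Prop :=
  ∃ x y z : P n → ℂ, IsUnitVec x ∧ IsUnitVec y ∧ IsUnitVec z ∧
    1 ≤ ‖triEval (fun a b c => matMulTensor ℂ n n n a b c - S a b c) x y z‖

/-- the critical Gram identity `S_(p)T_(p)^* = S_(p)S_(p)^*` in the three modes (card ccnf L1). -/
def CriticalGram {n : ℕ} (S : P n → P n → P n → ℂ) : Prop :=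
  (∀ a a' : P n, (∑ b, ∑ c, S a b c * conj (matMulTensor ℂ n n n a' b c)) = ∑ b, ∑ c, S a b c * conj (S a' b c)) ∧
    (∀ b b' : P n, (∑ a, ∑ c, S a b c * conj (matMulTensor ℂ n n n a b' c)) = ∑ a, ∑ c, S a b c * conj (S a b' c)) ∧
    (∀ c c' : P n, (∑ a, ∑ b, S a b c * conj (matMulTensor ℂ n n n a b c')) = ∑ a, ∑ b, S a b c * conj (S a b c'))

/-- some mode of `S` is killed by a rank-one matrix `η = u v^*` (an UNUSED rank-one DIRECTION; card ccnf). -/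
def HasUnusedDirection {n : ℕ} (S : P n → P n → P n → ℂ) : Prop :=
  (∃ u v : Fin n → ℂ, u ≠ 0 ∧ v ≠ 0 ∧ ∀ b c : P n, (∑ a : P n, conj (u a.1) * v a.2 * S a b c) = 0) ∨
    (∃ u v : Fin n → ℂ, u ≠ 0 ∧ v ≠ 0 ∧ ∀ a c : P n, (∑ b : P n, conj (u b.1) * v b.2 * S a b c) = 0) ∨
    (∃ u v : Fin n → ℂ, u ≠ 0 ∧ v ≠ 0 ∧ ∀ a b : P n, (∑ c : P n, conj (u c.1) * v c.2 * S a b c) = 0)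

/-- the exact-maximiser RESIDUAL SPECTRAL LAW at level `(n, r)`: every maximiser has a unit witness. -/
def RSL (n r : ℕ) : Prop := ∀ S : P n → P n → P n → ℂ, IsMaximiser n r S → UnitWitness n S

/-- S3a in vocabulary form. -/
theorem unitWitness_of_hasUnusedDirection {n : ℕ} (S : P n → P n → P n → ℂ) (h : HasUnusedDirection S) :
    UnitWitness n S :=
  stub_unusedDirection n S h

/-- S3b in vocabulary form. -/
theorem criticalGram_of_isMaximiser {n r : ℕ} (S : P n → P n → P n → ℂ) (h : IsMaximiser n r S) :
    CriticalGram S :=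
  stub_criticalGram n r S h.1 h.2.1 h.2.2.1 h.2.2.2

/-- S3d in vocabulary form. -/
theorem unitWitness_of_concise {n r : ℕ} (hw : 2 * n ≤ r) (hb : r < algBorderRank (matMulTensor ℂ n n n))
    (S : P n → P n → P n → ℂ) (h : IsMaximiser n r S) (hc : CriticalGram S) (hu : ¬ HasUnusedDirection S) :
    UnitWitness n S :=
  stub_core n r S hw hb h.1 h.2.1 h.2.2.1 h.2.2.2 hc hu

/-- **RSL on the window from the stubs** (case split: unused rank-one direction, or concise). -/
theorem rsl_of_stubs {n r : ℕ} (hw : 2 * n ≤ r) (hb : r < algBorderRank (matMulTensor ℂ n n n)) : RSL n r := by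
  intro S hS
  by_cases hu : HasUnusedDirection S
  · exact unitWitness_of_hasUnusedDirection S hu
  · exact unitWitness_of_concise hw hb S hS (criticalGram_of_isMaximiser S hS) hu

/-- **S3 — `SpectralResidual` on the window (the idea's lever)**, PROVED from the reshape-r1 stubs via `stub_passage`
(no longer a registered stub). For `2n − 1 ≤ r < R̲(⟨n,n,n⟩)` and every `ε > 0` there is `δ > 0` such that every NONZERO rank-`≤ r`
tensor `S` that is `δ`-optimal for the fidelity among rank-`≤ r` tensors leaves a residual `resid S = T − P_{ℂS}T` of
spectral norm² `≥ 1 − ε`: some unit triad `(x,y,z)` has `|resid S (x,y,z)|² ≥ 1 − ε` ("what is still missing always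
contains one whole unit triad"; by compactness of the projectivised problem this is EQUIVALENT to: every nearest point
`S_r ≠ T` of the closed cone `σ̂_r` — border limits included — has `‖T − S_r‖_σ ≥ 1`, the URL/RSL of the two sibling
cards). The `δ`-optimal HONEST form needs no closure / Alder–Strassen bookkeeping and covers non-attained suprema
(`(2,5)`: Bini, `LinearDefectLawNeg.linearDefectLaw_tight_two_five`).
WHY PLAUSIBLY TRUE. (a) It is the exact tensor shadow of the matrix fact behind the crux's heuristic
(Eckart–Young–Mirsky for a matrix with unit singular values: the best rank-`k` residual has operator norm
`σ_{k+1} = 1`); `T` is nuclear-flat (`‖T‖_σ = 1`, nuclear norm `n³ = ‖T‖²`, Derksen2015) and every partial matrix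
multiplication has spectral norm exactly `1`. (b) EQUALITY exactly where the crux is tight: `(2,6)` `resid = a₂₂b₂₂c₂₂`
(`linearDefectLaw_tight_two_six`), `(2,5)` `resid →` Bini pair `x₂₁y₁₂z₂₂ + x₂₂y₂₂z₂₂` (`‖·‖_σ = 1 < √2 = ‖·‖_F`), and
slack where the crux has slack. (c) NUMBERS (four independent codes, incl. pure-Lean `Float` replication by triage
r1-3 and two-sided brackets by r1-1/r1-2): `‖resid‖_σ` at the optima `= 1.004982 ∈ [1.00498, 1.41]` at `(2,3)`,
`∈ [1.0618, 1.0740]` at `(2,4)`, `∈ [1.00006, 1.00011]` at `(2,5)`, `= 1` at `(2,6)`; `n = 3`: `≥ 1` at all 17 levels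
`r = 2…18` of the ideator's scan (kit j010470; local optima for `r ≳ 14`) AND at the Smirnov-seeded window points of
triage r1-1 (kit j012293 C: `r = 19`: `[1.154, 1.201]` at `d₁₉ ≤ 2.330`; `r = 18`: `[1.00004, 1.0004]`; `r = 17`:
`[1.0002, 1.0029]`; `r = 16`: `[1.002, 1.415]`); 21 rectangular rungs of `⟨2,2,3⟩, ⟨2,3,3⟩, ⟨2,2,4⟩` (j012315)
never below `1`. (d) What a proof can hold on to at an exact optimum / nearest point `S_r` (entry lemmas, all
provable now, filed `--supports` by whoever proves S3): `resid ⟂` Terracini space (`E(·,v_l,w_l) = E(u_l,·,w_l) =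
E(u_l,v_l,·) = 0`: `S_r` reproduces the products of its own factor pairs exactly); full-group criticality
`S_(p)T_(p)^* = S_(p)S_(p)^* = n·K_p`, `0 ⪯ K_p ⪯ I`, `‖T − S_r‖² = n·tr(I − K_p)` and sub-format localisation
`resid ∈ ⊗_p ker(I − K_p)^⊥-complement` (`SketchIdeator1.CriticalGramIdentity` / `SubformatLocalisation`, verified by
all three triagers); `⟨resid, T⟩ = ‖resid‖²` with `T = n³ ∫_{K_T} k·e dk`, so `Σ_α Re⟨resid, k e_α⟩ = d_r` for EVERY
rotated frame (the mass `d_r ≥ 1` cannot be spread thinner than one unit over all frames at once — the claim);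
Kempf–Ness balance of `S_r` under `G_T = GL_n³`. ALIVE sharper forms (each ⇒ S3 with the triad EXHIBITED; triage r1-3):
nodal/OM form "some rotated unit product `t` of `T` has `⟨S_r, t⟩ = 0`" (`min |⟨S*,t⟩| = 0.000000` at `(2,3), (2,4)`),
coverage form "`min_t Re⟨S_r,t⟩ ≤ 0`" (`−0.0039`, `−0.035`). DEAD forms (do not use): PRL/NRL nuclear-duality
(`E_op` not Hermitian at `(2,3)/(2,4)`), Spectral Gap Conjecture on `K_p`, standard-frame deletion currency
(`max_α|⟨E,e_α⟩|² = 0.97…0.30 < 1` from `r = 2` on), `FreeUnitProduct` for ALL `S` beyond `r ≈ 3n − 2`, convexity of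
`r ↦ d_r`.
WHY IT MIGHT FAIL: a near-optimal `S` in the window `[2n² − O(1), R̲)` at `n ≥ 3` with a DIFFUSE residual
(`‖E‖ ≥ 1 > ‖E‖_σ`) — nobody can certify global optima there today (ALS misses Smirnov-type border schemes:
every random-restart scan reports `M(3,20) ≈ 25 < 27`); the top rung at `n ≥ 3` is probably not a deletion
(`R̲(T − e) = R̲(T)` plausible), so the unit must come from an "analog" residual. A refutation of S3 is NOT a
refutation of the crux (`UnitSlope` tolerates re-optimisation slack; the crux tolerates sub-unit increments at slack
rungs). -/
theorem stub_spectralResidual :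
    ∀ (n r : ℕ), 2 * n ≤ r → r < algBorderRank (matMulTensor ℂ n n n) →
      ∀ ε : ℝ, 0 < ε → ∃ δ : ℝ, 0 < δ ∧
        ∀ S : Fin n × Fin n → Fin n × Fin n → Fin n × Fin n → ℂ, tensorRank S ≤ r → S ≠ 0 →
          (∀ S' : Fin n × Fin n → Fin n × Fin n → Fin n × Fin n → ℂ, tensorRank S' ≤ r →
            ‖∑ a, ∑ b, ∑ c, S' a b c * matMulTensor ℂ n n n a b c‖ ^ 2 / (∑ a, ∑ b, ∑ c, ‖S' a b c‖ ^ 2) ≤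
              ‖∑ a, ∑ b, ∑ c, S a b c * matMulTensor ℂ n n n a b c‖ ^ 2 / (∑ a, ∑ b, ∑ c, ‖S a b c‖ ^ 2)
                + δ) →
          ∃ x y z : Fin n × Fin n → ℂ, (∑ i, ‖x i‖ ^ 2) = 1 ∧ (∑ i, ‖y i‖ ^ 2) = 1 ∧ (∑ i, ‖z i‖ ^ 2) = 1 ∧
            1 - ε ≤ ‖∑ a, ∑ b, ∑ c, (matMulTensor ℂ n n n a b c -
              (starRingEnd ℂ) (∑ a', ∑ b', ∑ c', S a' b' c' * matMulTensor ℂ n n n a' b' c') /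
                ((∑ a', ∑ b', ∑ c', ‖S a' b' c'‖ ^ 2 : ℝ) : ℂ) * S a b c) * x a * y b * z c‖ ^ 2 :=
  fun n r hw hb => stub_passage n r fun S h1 h2 h3 h4 => rsl_of_stubs hw hb S ⟨h1, h2, h3, h4⟩

/-! ## The stubs in the line's vocabulary (definitional unfoldings of the raw registered signatures) -/

/-- S1 in vocabulary form (`fid`, `resid`, `triEval`, `IsUnitVec` unfold definitionally to the registered raw
signature of `stub_oneStepGain`). -/
theorem oneStepGain :
    ∀ (n r : ℕ) (S : P n → P n → P n → ℂ) (x y z : P n → ℂ), tensorRank S ≤ r → S ≠ 0 →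
      IsUnitVec x → IsUnitVec y → IsUnitVec z →
      ∃ S' : P n → P n → P n → ℂ, tensorRank S' ≤ r + 1 ∧
        fid S + ‖triEval (resid S) x y z‖ ^ 2 ≤ fid S' :=
  stub_oneStepGain

/-- S2 in vocabulary form. -/
theorem freeUnitProduct :
    ∀ (n r : ℕ) (S : P n → P n → P n → ℂ), r + 2 ≤ 2 * n → tensorRank S ≤ r →
      ∃ x y z : P n → ℂ, IsUnitVec x ∧ IsUnitVec y ∧ IsUnitVec z ∧
        triEval S x y z = 0 ∧ triEval (matMulTensor ℂ n n n) x y z = 1 :=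
  stub_freeUnitProduct

/-- S2⁺ in vocabulary form (reshape r2: free regime `r ≤ 2n − 1`, `n ≥ 2`). -/
theorem freeUnitProductDet :
    ∀ (n r : ℕ) (S : P n → P n → P n → ℂ), 2 ≤ n → r + 1 ≤ 2 * n → tensorRank S ≤ r →
      ∃ x y z : P n → ℂ, IsUnitVec x ∧ IsUnitVec y ∧ IsUnitVec z ∧
        triEval S x y z = 0 ∧ triEval (matMulTensor ℂ n n n) x y z = 1 :=
  stub_freeUnitProductDet

/-- S3 in vocabulary form. -/
theorem spectralResidual :
    ∀ (n r : ℕ), 2 * n ≤ r → r < algBorderRank (matMulTensor ℂ n n n) →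
      ∀ ε : ℝ, 0 < ε → ∃ δ : ℝ, 0 < δ ∧
        ∀ S : P n → P n → P n → ℂ, tensorRank S ≤ r → S ≠ 0 →
          (∀ S' : P n → P n → P n → ℂ, tensorRank S' ≤ r → fid S' ≤ fid S + δ) →
          ∃ x y z : P n → ℂ, IsUnitVec x ∧ IsUnitVec y ∧ IsUnitVec z ∧
            1 - ε ≤ ‖triEval (resid S) x y z‖ ^ 2 :=
  stub_spectralResidual

/-! ## Elementary lemmas (proved) -/

theorem normSq_nonneg {n : ℕ} (S : P n → P n → P n → ℂ) : 0 ≤ normSq S := by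
  unfold normSq; positivity

theorem normSq_zero {n : ℕ} : normSq (0 : P n → P n → P n → ℂ) = 0 := by
  simp [normSq]

theorem overlap_zero {n : ℕ} : overlap (0 : P n → P n → P n → ℂ) = 0 := by
  simp [overlap]

theorem fid_zero {n : ℕ} : fid (0 : P n → P n → P n → ℂ) = 0 := by
  simp [fid, overlap_zero]

theorem fid_nonneg {n : ℕ} (S : P n → P n → P n → ℂ) : 0 ≤ fid S := by
  unfold fid
  exact div_nonneg (by positivity) (normSq_nonneg S)

theorem normSq_eq_zero_iff {n : ℕ} (S : P n → P n → P n → ℂ) : normSq S = 0 ↔ S = 0 := by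
  constructor
  · intro h
    funext a b c
    have ha := (Finset.sum_eq_zero_iff_of_nonneg (fun a _ => by positivity)).1 h a (Finset.mem_univ a)
    have hb := (Finset.sum_eq_zero_iff_of_nonneg (fun b _ => by positivity)).1 ha b (Finset.mem_univ b)
    have hc := (Finset.sum_eq_zero_iff_of_nonneg (fun c _ => by positivity)).1 hb c (Finset.mem_univ c)
    simpa using hc
  · rintro rfl
    exact normSq_zero

theorem normSq_pos_of_ne_zero {n : ℕ} {S : P n → P n → P n → ℂ} (hS : S ≠ 0) : 0 < normSq S :=
  (normSq_nonneg S).lt_of_ne' fun h => hS ((normSq_eq_zero_iff S).1 h)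

/-- a nonzero tensor lives in a nonempty format -/
theorem pos_of_ne_zero {n : ℕ} {S : P n → P n → P n → ℂ} (hS : S ≠ 0) : 0 < n := by
  rcases Nat.eq_zero_or_pos n with h0 | h
  · subst h0
    exact absurd (funext fun a => a.1.elim0) hS
  · exact h

/-! ## Level `r ≥ R̲`: Cauchy–Schwarz, `|Σ S·T|² ≤ n³ · Σ‖S‖²` (ideator's proof) -/

theorem norm_matMulTensor (n : ℕ) (a b c : P n) :
    ‖matMulTensor ℂ n n n a b c‖ = matMulTensor ℝ n n n a b c := by
  simp only [matMulTensor]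
  split_ifs <;> simp

theorem sq_matMulTensor_real (n : ℕ) (a b c : P n) :
    matMulTensor ℝ n n n a b c ^ 2 = matMulTensor ℝ n n n a b c := by
  simp only [matMulTensor]
  split_ifs <;> simp

/-- `Σ_{abc} ⟨n,n,n⟩_{abc} = n³` (number of unit products). -/
theorem sum_matMulTensor_real (n : ℕ) :
    (∑ a : P n, ∑ b : P n, ∑ c : P n, matMulTensor ℝ n n n a b c) = (n : ℝ) ^ 3 := by
  have h1 : ∀ a b : P n,
      (∑ c : P n, matMulTensor ℝ n n n a b c) = if a.1 = b.1 then 1 else 0 := by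
    intro a b
    by_cases hab : a.1 = b.1
    · rw [if_pos hab, Finset.sum_eq_single (b.2, a.2)]
      · simp [matMulTensor, hab]
      · intro c _ hc
        simp only [matMulTensor]
        rw [if_neg]
        rintro ⟨-, h2, h3⟩
        exact hc (Prod.ext h2.symm h3.symm)
      · intro h
        exact absurd (Finset.mem_univ _) h
    · rw [if_neg hab]
      exact Finset.sum_eq_zero fun c _ => by
        simp [matMulTensor, hab]
  have h2 : ∀ a : P n, (∑ b : P n, if a.1 = b.1 then (1 : ℝ) else 0) = n := by
    intro a
    rw [Fintype.sum_prod_type, Finset.sum_comm]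
    simp
  simp_rw [h1, h2]
  simp [Finset.sum_const, Finset.card_univ, Fintype.card_prod, Fintype.card_fin]
  ring

/-- **Cauchy–Schwarz at `⟨n,n,n⟩`:** `|Σ S·T|² ≤ n³·Σ‖S‖²` for every `S` (the law at every level `r ≥ R̲`). -/
theorem overlap_sq_le {n : ℕ} (S : P n → P n → P n → ℂ) :
    ‖overlap S‖ ^ 2 ≤ (n : ℝ) ^ 3 * normSq S := by
  let f : P n × P n × P n → ℝ := fun p => ‖S p.1 p.2.1 p.2.2‖
  let g : P n × P n × P n → ℝ := fun p => matMulTensor ℝ n n n p.1 p.2.1 p.2.2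
  have hle : ‖overlap S‖ ≤ ∑ p, f p * g p := by
    have step : ‖overlap S‖ ≤ ∑ a, ∑ b, ∑ c, ‖S a b c‖ * matMulTensor ℝ n n n a b c := by
      unfold overlap
      refine (norm_sum_le _ _).trans (Finset.sum_le_sum fun a _ => ?_)
      refine (norm_sum_le _ _).trans (Finset.sum_le_sum fun b _ => ?_)
      refine (norm_sum_le _ _).trans (Finset.sum_le_sum fun c _ => ?_)
      rw [norm_mul, norm_matMulTensor]
    simpa only [Fintype.sum_prod_type] using step
  have hf : (∑ p, f p ^ 2) = normSq S := by
    unfold normSq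
    simp only [Fintype.sum_prod_type, f]
  have hg : (∑ p, g p ^ 2) = (n : ℝ) ^ 3 := by
    rw [← sum_matMulTensor_real n]
    simp only [Fintype.sum_prod_type, g, sq_matMulTensor_real]
  have hcs : (∑ p, f p * g p) ^ 2 ≤ (∑ p, f p ^ 2) * ∑ p, g p ^ 2 :=
    Finset.sum_mul_sq_le_sq_mul_sq _ _ _
  rw [hf, hg] at hcs
  calc ‖overlap S‖ ^ 2 ≤ (∑ p, f p * g p) ^ 2 := pow_le_pow_left₀ (norm_nonneg _) hle 2
    _ ≤ normSq S * (n : ℝ) ^ 3 := hcs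
    _ = (n : ℝ) ^ 3 * normSq S := mul_comm _ _

/-- fidelity is at most `n³` (junk-safe). -/
theorem fid_le_cube {n : ℕ} (S : P n → P n → P n → ℂ) : fid S ≤ (n : ℝ) ^ 3 := by
  unfold fid
  rcases (normSq_nonneg S).eq_or_lt with h0 | hpos
  · rw [← h0, div_zero]; positivity
  · rw [div_le_iff₀ hpos]; exact overlap_sq_le S

/-! ## Glue `UnitSlope → LinearDefectLaw` (ideator's proof: telescoping downward from `r = R̲`) -/

/-- **`UnitSlope` implies the crux** (conclusion = the crux's body, so that only `LinearDefectLaw_of` below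
concludes the crux by name). -/
theorem law_of_unitSlope (h : UnitSlope) :
    ∀ n r : ℕ, ∀ S : Fin n × Fin n → Fin n × Fin n → Fin n × Fin n → ℂ, tensorRank S ≤ r →
      ‖∑ a, ∑ b, ∑ c, S a b c * matMulTensor ℂ n n n a b c‖ ^ 2 ≤
        ((n : ℝ) ^ 3 + (r : ℝ) - (algBorderRank (matMulTensor ℂ n n n) : ℝ)) *
          ∑ a, ∑ b, ∑ c, ‖S a b c‖ ^ 2 := by
  intro n r S hS
  obtain ⟨b, hb⟩ : ∃ b : ℕ, algBorderRank (matMulTensor ℂ n n n) = b := ⟨_, rfl⟩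
  have main : ∀ k r', r' + k = b → ∀ S₀ : P n → P n → P n → ℂ, tensorRank S₀ ≤ r' →
      ‖overlap S₀‖ ^ 2 ≤ ((n : ℝ) ^ 3 - k) * normSq S₀ := by
    intro k
    induction k with
    | zero =>
      intro r' _ S₀ _
      simpa using overlap_sq_le S₀
    | succ k ih =>
      intro r' hr' S₀ hS₀
      have hlt : r' < algBorderRank (matMulTensor ℂ n n n) := by rw [hb]; omega
      have hyp : ∀ S' : P n → P n → P n → ℂ, tensorRank S' ≤ r' + 1 →
          ‖overlap S'‖ ^ 2 ≤ ((n : ℝ) ^ 3 - k) * normSq S' := ih (r' + 1) (by omega)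
      have key := h n r' ((n : ℝ) ^ 3 - k) hlt hyp S₀ hS₀
      have e : (n : ℝ) ^ 3 - (k : ℝ) - 1 = (n : ℝ) ^ 3 - ((k + 1 : ℕ) : ℝ) := by
        push_cast; ring
      rw [e] at key
      exact key
  have goal : ‖overlap S‖ ^ 2 ≤ ((n : ℝ) ^ 3 + (r : ℝ) - (b : ℝ)) * normSq S := by
    by_cases hrb : r ≤ b
    · obtain ⟨k, hk⟩ : ∃ k, r + k = b := ⟨b - r, by omega⟩
      have hcast : (n : ℝ) ^ 3 + (r : ℝ) - (b : ℝ) = (n : ℝ) ^ 3 - (k : ℝ) := by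
        have : (b : ℝ) = (r : ℝ) + (k : ℝ) := by exact_mod_cast hk.symm
        rw [this]; ring
      rw [hcast]
      exact main k r hk S hS
    · have hbr : (b : ℝ) ≤ (r : ℝ) := by exact_mod_cast (Nat.lt_of_not_le hrb).le
      calc ‖overlap S‖ ^ 2 ≤ (n : ℝ) ^ 3 * normSq S := overlap_sq_le S
        _ ≤ ((n : ℝ) ^ 3 + (r : ℝ) - (b : ℝ)) * normSq S := by
          apply mul_le_mul_of_nonneg_right _ (normSq_nonneg S)
          linarith
  rw [hb]
  simpa only [overlap, normSq] using goal

/-! ## Composition lemmas (proved): from the stubs to `UnitSlope` -/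

/-- linearity of trilinear evaluation in the residual: `resid S (x,y,z) = T(x,y,z) − k·S(x,y,z)`. -/
theorem triEval_resid {n : ℕ} (S : P n → P n → P n → ℂ) (x y z : P n → ℂ) :
    triEval (resid S) x y z =
      triEval (matMulTensor ℂ n n n) x y z - (conj (overlap S) / (normSq S : ℂ)) * triEval S x y z := by
  simp only [triEval, resid, sub_mul, Finset.sum_sub_distrib, Finset.mul_sum, mul_assoc]

/-- a standard unit product `e_a₀ ⊗ e_a₀ ⊗ e_a₀` (`a₀ = (0,0)`): rank `≤ 1`, overlap `1`, norm² `1`. -/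
theorem exists_unitProduct {n : ℕ} (hn : 0 < n) :
    ∃ S₀ : P n → P n → P n → ℂ, tensorRank S₀ ≤ 1 ∧ overlap S₀ = 1 ∧ normSq S₀ = 1 := by
  let i : Fin n := ⟨0, hn⟩
  let e : P n → ℂ := Pi.single (i, i) 1
  have hval : ∀ a b c : P n, triad e e e a b c =
      if c = (i, i) then (if b = (i, i) then (if a = (i, i) then 1 else 0) else 0) else 0 := by
    intro a b c
    by_cases ha : a = (i, i) <;> by_cases hb : b = (i, i) <;> by_cases hc : c = (i, i) <;>
      simp [e, ha, hb, hc]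
  refine ⟨triad e e e, ?_, ?_, ?_⟩
  · exact tensorRank_le_of_eq_sum (fun _ : Fin 1 => e) (fun _ => e) (fun _ => e) (by simp)
  · have h : ∀ a b c : P n, triad e e e a b c * matMulTensor ℂ n n n a b c =
        if c = (i, i) then (if b = (i, i) then (if a = (i, i) then 1 else 0) else 0) else 0 := by
      intro a b c
      rw [hval]
      by_cases ha : a = (i, i) <;> by_cases hb : b = (i, i) <;> by_cases hc : c = (i, i) <;>
        simp [matMulTensor, ha, hb, hc]
    unfold overlap
    simp_rw [h]
    simp only [Finset.sum_ite_eq', Finset.mem_univ, if_true]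
  · have h : ∀ a b c : P n, ‖triad e e e a b c‖ ^ 2 =
        if c = (i, i) then (if b = (i, i) then (if a = (i, i) then (1 : ℝ) else 0) else 0) else 0 := by
      intro a b c
      rw [hval]
      by_cases ha : a = (i, i) <;> by_cases hb : b = (i, i) <;> by_cases hc : c = (i, i) <;>
        simp [ha, hb, hc]
    unfold normSq
    simp_rw [h]
    simp only [Finset.sum_ite_eq', Finset.mem_univ, if_true]

/-- from a certified gain at rank `r + 1` to a bound at rank `r` (junk-safe in `fid`). -/
theorem fid_le_of_gain {n r : ℕ} {c : ℝ}
    (hc : ∀ S' : P n → P n → P n → ℂ, tensorRank S' ≤ r + 1 → ‖overlap S'‖ ^ 2 ≤ c * normSq S')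
    {S S' : P n → P n → P n → ℂ} (hS' : tensorRank S' ≤ r + 1) {g : ℝ} (hg : 0 < g)
    (h : fid S + g ≤ fid S') : fid S ≤ c - g := by
  have key := hc S' hS'
  have h0S := fid_nonneg S
  rcases (normSq_nonneg S').eq_or_lt with h0 | hpos
  · have hz : fid S' = 0 := by
      unfold fid
      rw [← h0, div_zero]
    linarith
  · have hle : fid S' ≤ c := by
      unfold fid
      rw [div_le_iff₀ hpos]
      exact key
    linarith

/-- `UnitSlope` at one level `(n, r)`. -/
def SlopeAt (n r : ℕ) : Prop :=
  ∀ c : ℝ, (∀ S' : P n → P n → P n → ℂ, tensorRank S' ≤ r + 1 → ‖overlap S'‖ ^ 2 ≤ c * normSq S') →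
    ∀ S : P n → P n → P n → ℂ, tensorRank S ≤ r → ‖overlap S‖ ^ 2 ≤ (c - 1) * normSq S

/-- **Below the window** (`r ≤ 2n − 2`): S1 + S2 give the unit slope at level `r` for every `S`, no optimality. -/
theorem slope_small
    (h1 : ∀ (n r : ℕ) (S : P n → P n → P n → ℂ) (x y z : P n → ℂ), tensorRank S ≤ r → S ≠ 0 →
      IsUnitVec x → IsUnitVec y → IsUnitVec z →
      ∃ S' : P n → P n → P n → ℂ, tensorRank S' ≤ r + 1 ∧
        fid S + ‖triEval (resid S) x y z‖ ^ 2 ≤ fid S')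
    (h2 : ∀ (n r : ℕ) (S : P n → P n → P n → ℂ), 2 ≤ n → r + 1 ≤ 2 * n → tensorRank S ≤ r →
      ∃ x y z : P n → ℂ, IsUnitVec x ∧ IsUnitVec y ∧ IsUnitVec z ∧
        triEval S x y z = 0 ∧ triEval (matMulTensor ℂ n n n) x y z = 1)
    (n r : ℕ) (hn : 2 ≤ n) (hr : r + 1 ≤ 2 * n) : SlopeAt n r := by
  intro c hc S hS
  by_cases hS0 : S = 0
  · subst hS0
    rw [overlap_zero, normSq_zero]
    simp
  obtain ⟨x, y, z, hx, hy, hz, hSxyz, hTxyz⟩ := h2 n r S hn hr hS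
  obtain ⟨S', hS'r, hgain⟩ := h1 n r S x y z hS hS0 hx hy hz
  rw [triEval_resid, hSxyz, hTxyz] at hgain
  simp only [mul_zero, sub_zero, norm_one, one_pow] at hgain
  have hfid : fid S ≤ c - 1 := fid_le_of_gain hc hS'r one_pos hgain
  have hns : 0 < normSq S := normSq_pos_of_ne_zero hS0
  unfold fid at hfid
  rwa [div_le_iff₀ hns] at hfid

/-- **On the window** (`2n − 1 ≤ r < R̲`): S1 + S3 give the unit slope at level `r` — the `sup`-bookkeeping over
`δ`-optimal tensors (`M_r := sup {fid S : rank S ≤ r} ≤ c − 1`). -/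
theorem slope_window
    (h1 : ∀ (n r : ℕ) (S : P n → P n → P n → ℂ) (x y z : P n → ℂ), tensorRank S ≤ r → S ≠ 0 →
      IsUnitVec x → IsUnitVec y → IsUnitVec z →
      ∃ S' : P n → P n → P n → ℂ, tensorRank S' ≤ r + 1 ∧
        fid S + ‖triEval (resid S) x y z‖ ^ 2 ≤ fid S')
    (h3 : ∀ (n r : ℕ), 2 * n ≤ r → r < algBorderRank (matMulTensor ℂ n n n) →
      ∀ ε : ℝ, 0 < ε → ∃ δ : ℝ, 0 < δ ∧
        ∀ S : P n → P n → P n → ℂ, tensorRank S ≤ r → S ≠ 0 →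
          (∀ S' : P n → P n → P n → ℂ, tensorRank S' ≤ r → fid S' ≤ fid S + δ) →
          ∃ x y z : P n → ℂ, IsUnitVec x ∧ IsUnitVec y ∧ IsUnitVec z ∧
            1 - ε ≤ ‖triEval (resid S) x y z‖ ^ 2)
    (n r : ℕ) (hw : 2 * n ≤ r) (hb : r < algBorderRank (matMulTensor ℂ n n n)) : SlopeAt n r := by
  intro c hc S hS
  by_cases hS0 : S = 0
  · subst hS0
    rw [overlap_zero, normSq_zero]
    simp
  -- the format is nonempty, so the unit product certifies `c ≥ 1`
  have hn : 0 < n := pos_of_ne_zero hS0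
  obtain ⟨S₀, hS₀r, hS₀o, hS₀n⟩ := exists_unitProduct hn
  have hc1 : 1 ≤ c := by
    have h := hc S₀ (hS₀r.trans (by omega))
    rw [hS₀o, hS₀n] at h
    simpa using h
  -- `M_r = sSup F`, `F` the fidelities of rank-`≤ r` tensors
  set F : Set ℝ := fid '' {S' : P n → P n → P n → ℂ | tensorRank S' ≤ r} with hF
  have hFne : F.Nonempty := ⟨fid S, S, hS, rfl⟩
  have hFbdd : BddAbove F := by
    refine ⟨(n : ℝ) ^ 3, fun f hf => ?_⟩
    obtain ⟨S', -, rfl⟩ := hf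
    exact fid_le_cube S'
  have hM : ∀ S' : P n → P n → P n → ℂ, tensorRank S' ≤ r → fid S' ≤ sSup F :=
    fun S' h => le_csSup hFbdd ⟨S', h, rfl⟩
  -- main claim: `M_r ≤ c − 1`
  have hmain : sSup F ≤ c - 1 := by
    apply le_of_forall_pos_le_add
    intro η hη
    obtain ⟨δ, hδ, hSR⟩ := h3 n r hw hb (min (η / 2) (1 / 2)) (lt_min (by linarith) (by norm_num))
    have hε1 : min (η / 2) (1 / 2) ≤ η / 2 := min_le_left _ _
    have hε2 : min (η / 2) (1 / 2) ≤ 1 / 2 := min_le_right _ _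
    have hδ' : 0 < min δ (η / 2) := lt_min hδ (by linarith)
    have hδ1 : min δ (η / 2) ≤ δ := min_le_left _ _
    have hδ2 : min δ (η / 2) ≤ η / 2 := min_le_right _ _
    obtain ⟨f, hf, hlt⟩ := exists_lt_of_lt_csSup hFne (show sSup F - min δ (η / 2) < sSup F by linarith)
    obtain ⟨S₁, hS₁, rfl⟩ := hf
    by_cases hS₁0 : S₁ = 0
    · subst hS₁0
      rw [fid_zero] at hlt
      linarith
    · have hopt : ∀ S' : P n → P n → P n → ℂ, tensorRank S' ≤ r → fid S' ≤ fid S₁ + δ :=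
        fun S' h => (hM S' h).trans (by linarith)
      obtain ⟨x, y, z, hx, hy, hz, hge⟩ := hSR S₁ hS₁ hS₁0 hopt
      obtain ⟨S', hS'r, hgain⟩ := h1 n r S₁ x y z hS₁ hS₁0 hx hy hz
      have hg : 0 < 1 - min (η / 2) (1 / 2) := by linarith
      have hfid : fid S₁ ≤ c - (1 - min (η / 2) (1 / 2)) :=
        fid_le_of_gain hc hS'r hg (le_trans (by linarith) hgain)
      linarith
  -- conclude for the given `S`
  have hfS : fid S ≤ c - 1 := (hM S hS).trans hmain
  have hns : 0 < normSq S := normSq_pos_of_ne_zero hS0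
  unfold fid at hfS
  rwa [div_le_iff₀ hns] at hfS

/-- **`UnitSlope` from the three stubs** (regime split at `r = 2n − 2`). -/
theorem unitSlope_of_stubs
    (h1 : ∀ (n r : ℕ) (S : P n → P n → P n → ℂ) (x y z : P n → ℂ), tensorRank S ≤ r → S ≠ 0 →
      IsUnitVec x → IsUnitVec y → IsUnitVec z →
      ∃ S' : P n → P n → P n → ℂ, tensorRank S' ≤ r + 1 ∧
        fid S + ‖triEval (resid S) x y z‖ ^ 2 ≤ fid S')
    (h2 : ∀ (n r : ℕ) (S : P n → P n → P n → ℂ), 2 ≤ n → r + 1 ≤ 2 * n → tensorRank S ≤ r →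
      ∃ x y z : P n → ℂ, IsUnitVec x ∧ IsUnitVec y ∧ IsUnitVec z ∧
        triEval S x y z = 0 ∧ triEval (matMulTensor ℂ n n n) x y z = 1)
    (h3 : ∀ (n r : ℕ), 2 * n ≤ r → r < algBorderRank (matMulTensor ℂ n n n) →
      ∀ ε : ℝ, 0 < ε → ∃ δ : ℝ, 0 < δ ∧
        ∀ S : P n → P n → P n → ℂ, tensorRank S ≤ r → S ≠ 0 →
          (∀ S' : P n → P n → P n → ℂ, tensorRank S' ≤ r → fid S' ≤ fid S + δ) →
          ∃ x y z : P n → ℂ, IsUnitVec x ∧ IsUnitVec y ∧ IsUnitVec z ∧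
            1 - ε ≤ ‖triEval (resid S) x y z‖ ^ 2) :
    UnitSlope := by
  intro n r c hb hc S hS
  by_cases hS0 : S = 0
  · subst hS0
    rw [overlap_zero, normSq_zero]
    simp
  rcases le_or_gt 2 n with hn | hn
  · rcases Nat.lt_or_ge r (2 * n) with hsmall | hbig
    · exact slope_small h1 h2 n r hn (by omega) c hc S hS
    · exact slope_window h1 h3 n r hbig hb c hc S hS
  · -- `n ≤ 1`: `R̲(⟨n,n,n⟩) ≤ R(⟨n,n,n⟩) ≤ n³ ≤ 1`, so `r = 0` and `S = 0`
    exfalso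
    have hT : algBorderRank (matMulTensor ℂ n n n) ≤ 1 :=
      calc algBorderRank (matMulTensor ℂ n n n) ≤ tensorRank (matMulTensor ℂ n n n) :=
            algBorderRank_le_tensorRank _
        _ ≤ n * n * n := tensorRank_matMulTensor_le (K := ℂ) n n n
        _ ≤ 1 := by interval_cases n <;> norm_num
    have hr0 : r = 0 := by omega
    subst hr0
    obtain ⟨w, u, v, hSdec⟩ := exists_eq_sum_triad_of_tensorRank_le hS
    exact hS0 (by rw [hSdec]; simp)

/-! ## The composition (kernel-checked, no `sorry` of its own) -/

/-- **Pure-logic composition, explicit-hypothesis form** (conclusion = the crux's body): S1, S2, S3 ⇒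
`UnitSlope` ⇒ `LinearDefectLaw`. -/
theorem linearDefectLaw_of_stubs
    (h1 : ∀ (n r : ℕ) (S : P n → P n → P n → ℂ) (x y z : P n → ℂ), tensorRank S ≤ r → S ≠ 0 →
      IsUnitVec x → IsUnitVec y → IsUnitVec z →
      ∃ S' : P n → P n → P n → ℂ, tensorRank S' ≤ r + 1 ∧
        fid S + ‖triEval (resid S) x y z‖ ^ 2 ≤ fid S')
    (h2 : ∀ (n r : ℕ) (S : P n → P n → P n → ℂ), 2 ≤ n → r + 1 ≤ 2 * n → tensorRank S ≤ r →
      ∃ x y z : P n → ℂ, IsUnitVec x ∧ IsUnitVec y ∧ IsUnitVec z ∧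
        triEval S x y z = 0 ∧ triEval (matMulTensor ℂ n n n) x y z = 1)
    (h3 : ∀ (n r : ℕ), 2 * n ≤ r → r < algBorderRank (matMulTensor ℂ n n n) →
      ∀ ε : ℝ, 0 < ε → ∃ δ : ℝ, 0 < δ ∧
        ∀ S : P n → P n → P n → ℂ, tensorRank S ≤ r → S ≠ 0 →
          (∀ S' : P n → P n → P n → ℂ, tensorRank S' ≤ r → fid S' ≤ fid S + δ) →
          ∃ x y z : P n → ℂ, IsUnitVec x ∧ IsUnitVec y ∧ IsUnitVec z ∧
            1 - ε ≤ ‖triEval (resid S) x y z‖ ^ 2) :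
    ∀ n r : ℕ, ∀ S : Fin n × Fin n → Fin n × Fin n → Fin n × Fin n → ℂ, tensorRank S ≤ r →
      ‖∑ a, ∑ b, ∑ c, S a b c * matMulTensor ℂ n n n a b c‖ ^ 2 ≤
        ((n : ℝ) ^ 3 + (r : ℝ) - (algBorderRank (matMulTensor ℂ n n n) : ℝ)) *
          ∑ a, ∑ b, ∑ c, ‖S a b c‖ ^ 2 :=
  law_of_unitSlope (unitSlope_of_stubs h1 h2 h3)

/-- **`LinearDefectLaw` from the three stubs** (concludes the crux decl BY NAME). -/
theorem LinearDefectLaw_of : LinearDefectLaw := by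
  intro n r S hS
  exact linearDefectLaw_of_stubs oneStepGain freeUnitProductDet spectralResidual n r S hS

/-! ## Consistency with the landed Negative lane (the stub constants are forced) -/

/-- **The unit in `UnitSlope` cannot be raised**: for every `η > 0` the strengthening "`c − 1 − η` bounds rank `r`"
is FALSE — at `(n, r) = (2, 6)` (`6 < 7 = R̲(⟨2,2,2⟩)`, tree theorem `algBorderRank_matMulTensor_two`) the constant
`c = 8` bounds rank `7` (Cauchy–Schwarz) while the honest rank-6 tensor `⟨2,2,2⟩ − a₂₂⊗b₂₂⊗c₂₂` of the landed
`linearDefectLaw_tight_two_six` has ratio exactly `7 > 8 − 1 − η`. So S3 is stated at the only admissible gain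
(`1 − ε` at `δ`-optima), matching Disproof § (b)/(c1) (`tight_two_six`, `not_linearDefectLaw_slack`). -/
theorem unitSlope_not_strengthened (η : ℝ) (hη : 0 < η) :
    ¬ ∀ (n r : ℕ) (c : ℝ), r < algBorderRank (matMulTensor ℂ n n n) →
      (∀ S' : P n → P n → P n → ℂ, tensorRank S' ≤ r + 1 → ‖overlap S'‖ ^ 2 ≤ c * normSq S') →
      ∀ S : P n → P n → P n → ℂ, tensorRank S ≤ r → ‖overlap S‖ ^ 2 ≤ (c - 1 - η) * normSq S := by
  intro h
  obtain ⟨S, hS, hN, hEq⟩ := linearDefectLaw_tight_two_six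
  have hb : 6 < algBorderRank (matMulTensor ℂ 2 2 2) := by
    rw [algBorderRank_matMulTensor_two ℂ]; norm_num
  have hcs : ∀ S' : P 2 → P 2 → P 2 → ℂ, tensorRank S' ≤ 6 + 1 → ‖overlap S'‖ ^ 2 ≤ 8 * normSq S' := by
    intro S' _
    have h8 := overlap_sq_le S'
    norm_num at h8
    exact h8
  have key := h 2 6 8 hb hcs S hS
  simp only [overlap, normSq] at key
  rw [hEq, hN] at key
  norm_num at key
  linarith

/-- **Where the law's slack lives** (modulo S1, S2 — both provable now): below the window the slope is a
THEOREM of the line, e.g. `M(n, r+1) ≥ M(n, r) + 1` for all `n` and all `r ≤ 2n − 2`; the crux's difficulty is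
confined to the window `2n − 1 ≤ r < R̲(⟨n,n,n⟩)` handled by S3. -/
theorem slope_below_window (n r : ℕ) (hn : 2 ≤ n) (hr : r + 1 ≤ 2 * n) : SlopeAt n r :=
  slope_small oneStepGain freeUnitProductDet n r hn hr

/-- Cauchy–Schwarz at `n = 2` in the shape of a level hypothesis: `8` bounds every rank. -/
theorem eight_bounds_two (r : ℕ) :
    ∀ S' : P 2 → P 2 → P 2 → ℂ, tensorRank S' ≤ r → ‖overlap S'‖ ^ 2 ≤ 8 * normSq S' := by
  intro S' _
  have h8 := overlap_sq_le S'
  norm_num at h8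
  exact h8

/-- **First window instance = the route's lead instance.** S1 and S3 at the single level `(n, r) = (2, 6)`
(`6 < 7 = R̲(⟨2,2,2⟩)`, tree) already give `M(2,6) ≤ 7`, i.e. the body of the sibling crux `SevenEighthsLaw`
(stmt-MatrixMultiplication-4959): the constant `8` bounds rank `7` by Cauchy–Schwarz, so `8 − 1` bounds rank `6`.
Hence S3 is at least as hard as the lead instance, and a proof of S3 at `(2,6)` is a new proof route to it
(explicit-hypothesis form; nothing is claimed unconditionally). -/
theorem sevenEighths_of_window_two_six
    (h1 : ∀ (n r : ℕ) (S : P n → P n → P n → ℂ) (x y z : P n → ℂ), tensorRank S ≤ r → S ≠ 0 →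
      IsUnitVec x → IsUnitVec y → IsUnitVec z →
      ∃ S' : P n → P n → P n → ℂ, tensorRank S' ≤ r + 1 ∧
        fid S + ‖triEval (resid S) x y z‖ ^ 2 ≤ fid S')
    (h3 : ∀ (n r : ℕ), 2 * n ≤ r → r < algBorderRank (matMulTensor ℂ n n n) →
      ∀ ε : ℝ, 0 < ε → ∃ δ : ℝ, 0 < δ ∧
        ∀ S : P n → P n → P n → ℂ, tensorRank S ≤ r → S ≠ 0 →
          (∀ S' : P n → P n → P n → ℂ, tensorRank S' ≤ r → fid S' ≤ fid S + δ) →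
          ∃ x y z : P n → ℂ, IsUnitVec x ∧ IsUnitVec y ∧ IsUnitVec z ∧
            1 - ε ≤ ‖triEval (resid S) x y z‖ ^ 2) :
    ∀ S : P 2 → P 2 → P 2 → ℂ, tensorRank S ≤ 6 → ‖overlap S‖ ^ 2 ≤ 7 * normSq S := by
  intro S hS
  have hb : 6 < algBorderRank (matMulTensor ℂ 2 2 2) := by
    rw [algBorderRank_matMulTensor_two ℂ]; norm_num
  have key := slope_window h1 h3 2 6 (by norm_num) hb 8 (eight_bounds_two 7) S hS
  norm_num at key
  exact key

/-- **Second window instance = the support item `SixEighthsAtFive`** (stmt-MatrixMultiplication-14040): S1 and S3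
at the two levels `(2,6)` and `(2,5)` give `M(2,5) ≤ 6` (Bini-tight on the border:
`LinearDefectLawNeg.linearDefectLaw_tight_two_five`). -/
theorem sixEighths_of_window_two_five
    (h1 : ∀ (n r : ℕ) (S : P n → P n → P n → ℂ) (x y z : P n → ℂ), tensorRank S ≤ r → S ≠ 0 →
      IsUnitVec x → IsUnitVec y → IsUnitVec z →
      ∃ S' : P n → P n → P n → ℂ, tensorRank S' ≤ r + 1 ∧
        fid S + ‖triEval (resid S) x y z‖ ^ 2 ≤ fid S')
    (h3 : ∀ (n r : ℕ), 2 * n ≤ r → r < algBorderRank (matMulTensor ℂ n n n) →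
      ∀ ε : ℝ, 0 < ε → ∃ δ : ℝ, 0 < δ ∧
        ∀ S : P n → P n → P n → ℂ, tensorRank S ≤ r → S ≠ 0 →
          (∀ S' : P n → P n → P n → ℂ, tensorRank S' ≤ r → fid S' ≤ fid S + δ) →
          ∃ x y z : P n → ℂ, IsUnitVec x ∧ IsUnitVec y ∧ IsUnitVec z ∧
            1 - ε ≤ ‖triEval (resid S) x y z‖ ^ 2) :
    ∀ S : P 2 → P 2 → P 2 → ℂ, tensorRank S ≤ 5 → ‖overlap S‖ ^ 2 ≤ 6 * normSq S := by
  intro S hS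
  have hb : 5 < algBorderRank (matMulTensor ℂ 2 2 2) := by
    rw [algBorderRank_matMulTensor_two ℂ]; norm_num
  have h7 : ∀ S' : P 2 → P 2 → P 2 → ℂ, tensorRank S' ≤ 5 + 1 → ‖overlap S'‖ ^ 2 ≤ 7 * normSq S' :=
    fun S' hS' => sevenEighths_of_window_two_six h1 h3 S' hS'
  have key := slope_window h1 h3 2 5 (by norm_num) hb 7 h7 S hS
  norm_num at key
  exact key

end Summit.MatrixMultiplication.MatrixMultiplication.Cruxes.LinearDefectLaw.BorderSingularValues

end
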